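import Summits.HodgeConjecture.HodgeConjecture.Theses.NikulinTwinTransport

/-!
# Route NikulinTwinTransport — the target `TwinSimilitudeAlgebraic` (X = Sim₂(K3)) reduced to an
# algebraic anchor similitude, Buskin's theorem and the composition of correspondences

Item stmt-HodgeConjecture-13674 (`TwinSimilitudeAlgebraic`, the route's TARGET X): for projective K3
surfaces `S, S′` over `ℂ`, every `ℂ`-linear `ψ : H²(S′(ℂ); ℂ) → H²(S(ℂ); ℂ)` which is rational,
type-preserving and a `2`-similitude (`(x.y) = a·p′ ⟹ (ψx.ψy) = 2a·p`, `p, p′` integral generators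
of `H⁴`) is `[γ]_* = fst_* (snd^* (–) ∪ γ)` for an algebraic class `γ` of codimension `2` on
`S × S′`. The route file asserts, informally, that X is "Equivalent (Buskin + composition of
correspondences) to 'graph(Ψ) is algebraic on every twin pair of the one completed Nikulin
2-similitude Ψ'", and the informal crux TwinTwistorTransport (stmt-HodgeConjecture-14522, clause (c))
ends "dividing by m, graph(Ψ) is algebraic on S × S′; with HodgeIsometryAlgebraic (Buskin) this is
X = TwinSimilitudeAlgebraic for all pairs and all rational 2-similitudes (Ψ⁻¹∘ψ is a rational Hodge
isometry)". This file PROVES that last implication on the route's real carriers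
(`complexBetti`, `cupProduct`, `complexGysin`, `algebraicClasses`), for an arbitrary multiplier
`r : ℂ`, from three hypotheses written out in the vocabulary of the route file (no new definitions;
a planner may file (C) and (A) verbatim as the children of a glued split of X, D-0019):

* (B) `HodgeIsometryAlgebraic` — the route's support item stmt-HodgeConjecture-13675, verbatim the
  body of the named fact `Literature.AlgebraicGeometry.Surfaces.Buskin2019_hodgeIsometry_algebraic`
  (Buskin, J. reine angew. Math. 755 (2019), Thm. 1.1; Huybrechts, Comment. Math. Helv. 94 (2019)).
* (C) COMPOSITION OF ALGEBRAIC CORRESPONDENCES between smooth projective surfaces `A, B, C`: for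
  algebraic `γ ∈ N² H⁴(A × B)`, `γ₁ ∈ N² H⁴(B × C)` there is an algebraic `γ₂ ∈ N² H⁴(A × C)` with
  `[γ₂]_* = [γ]_* ∘ [γ₁]_*` on `H²(C(ℂ); ℂ)` (in print: `γ₂ = γ ∘ γ₁ = p_{AC*}(p_{AB}^* γ · p_{BC}^* γ₁)`,
  Fulton, *Intersection Theory* §16.1, with the cycle class map; on the tree's carriers this is the
  formal debt "composition / transpose of algebraic correspondences" named in the route text —
  Gysin base change for product squares and the moving-lemma input of
  `Literature.AlgebraicGeometry.HodgeTheory.cupProduct_mem_algebraicClasses_of_moving`, neither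
  of which the tree has yet; it is therefore a HYPOTHESIS here, not a vendored fact).
* (A) ALGEBRAIC ANCHOR `r`-SIMILITUDE: every projective K3 surface `S` (with an integral generator
  `p` of `H⁴`) has a projective K3 partner `S″` (generator `p″`) and a `ℂ`-linear equivalence
  `Ψ : H²(S″(ℂ); ℂ) ≃ H²(S(ℂ); ℂ)` which is ALGEBRAIC (`Ψ = [γ]_*`, `γ ∈ N² H⁴(S × S″)`) and whose
  inverse is rational, type-preserving and divides the form by `r`
  (`(u.v) = r b·p ⟹ (Ψ⁻¹u.Ψ⁻¹v) = b·p″`). For `r = 2` this is exactly what the route's mechanism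
  (NikulinSerreCarrier → TwinTwistorTransport → GAGA endpoint) is meant to deliver on the twin
  `S″` of `S`: the completed Nikulin `2`-similitude `Ψ`, Hodge on the twin pair, with graph(Ψ)
  algebraic; only the properties of `Ψ⁻¹` actually consumed are required (they follow in print from
  `Ψ` being a rational Hodge `2`-similitude, `H⁴ = ℂ·p″`, `p ≠ 0`).

PROOF (`similitudeAlgebraic_of_anchor`): given `ψ : H²(S′) → H²(S)`, take the anchor
`(S″, p″, Ψ, γ)` of `S`; `φ := Ψ⁻¹ ∘ ψ : H²(S′) → H²(S″)` is rational, type-preserving and an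
ISOMETRY (`(x.y) = a p′ ⟹ (ψx.ψy) = r a p ⟹ (φx.φy) = a p″`), hence `φ = [γ₁]_*` by (B) applied to
the K3 pair `(S″, S′)`; then `ψ = Ψ ∘ φ = [γ]_* ∘ [γ₁]_* = [γ₂]_*` by (C). Corollaries:
`twinSimilitudeAlgebraic_of_anchor` (`r = 2`, concludes the route decl `TwinSimilitudeAlgebraic`)
and `hodgeSimilitudeAlgebraic_of_anchor` (all `r : ℚ`, `0 < r`, concludes the route decl
`HodgeSimilitudeAlgebraic`, item stmt-HodgeConjecture-13676). No step uses `r ≠ 0`.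

What this file does NOT do: it does not prove X (an open sub-case of the Hodge conjecture:
Varesco, Math. Z. 305 (2023), Thm. 2.1 covers only the Nikulin locus), nor (A), (B), (C).
Prover seat prover-HodgeConjecture-route-HodgeConjecture-NikulinTwinTransport-0, 2026-08-15.
-/

noncomputable section

namespace Summit.HodgeConjecture.HodgeConjecture.Theorems

open scoped Manifold
open CategoryTheory
open Literature.AlgebraicGeometry.HodgeTheory Literature.AlgebraicGeometry.Motives
open Literature.AlgebraicTopology.SingularHomology Literature.Geometry.Kaehler
open Summit.HodgeConjecture.HodgeConjecture.Theses.NikulinTwinTransport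

/-- **Reduction of "every rational Hodge `r`-similitude between projective K3 surfaces is
algebraic" to an algebraic anchor `r`-similitude, Buskin's theorem and the composition of
algebraic correspondences** (the glue asserted informally by route NikulinTwinTransport for its
target X, clause (c) of crux TwinTwistorTransport). Hypotheses: (B) the route decl
`HodgeIsometryAlgebraic` (Buskin 2019, Thm. 1.1, as rendered in the tree); (C) composition of
algebraic degree-`2` correspondences between smooth projective surfaces acts as an algebraic
correspondence; (A) every projective K3 surface `S` with integral generator `p` of `H⁴` admits a
projective K3 partner `S″`, `p″`, and an algebraic `ℂ`-linear equivalence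
`Ψ : H²(S″(ℂ); ℂ) ≃ H²(S(ℂ); ℂ)` whose inverse is rational, type-preserving and divides the cup
form by `r`. Conclusion: every rational, type-preserving `r`-similitude
`ψ : H²(S′(ℂ); ℂ) → H²(S(ℂ); ℂ)` between projective K3 surfaces is `fst_* (snd^* (–) ∪ γ₂)` for an
algebraic `γ₂` on `S × S′`. Proof: `Ψ⁻¹ ∘ ψ` is a rational Hodge isometry `H²(S′) → H²(S″)`, algebraic
by (B); compose with `Ψ` by (C). [folklore] -/
theorem similitudeAlgebraic_of_anchor (r : ℂ) (hB : HodgeIsometryAlgebraic)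
    (hC : ∀ (μ : OrientationFamily), μ.HasPoincareDuality →
      ∀ (A B C : SchemeOver ℂ) (hA : IsSmoothProjective 2 A) (hB : IsSmoothProjective 2 B)
        (hC : IsSmoothProjective 2 C),
        ∀ γ ∈ algebraicClasses (MonoidalCategoryStruct.tensorObj A B) 2,
          ∀ γ₁ ∈ algebraicClasses (MonoidalCategoryStruct.tensorObj B C) 2,
            ∃ γ₂ ∈ algebraicClasses (MonoidalCategoryStruct.tensorObj A C) 2,
              ∀ x : complexBetti C (2 * 1),
                complexGysin μ (IsSmoothProjective.tensor_holds hA hC) hA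
                    (SemiCartesianMonoidalCategory.fst A C)
                    (rfl : 2 * 1 + 2 * 2 + 2 * 2 = 2 * 1 + 2 * (2 + 2))
                    (cupProduct (rfl : 2 * 1 + 2 * 2 = 2 * 1 + 2 * 2)
                      (complexBetti.map (SemiCartesianMonoidalCategory.snd A C) (2 * 1) x) γ₂) =
                  complexGysin μ (IsSmoothProjective.tensor_holds hA hB) hA
                    (SemiCartesianMonoidalCategory.fst A B)
                    (rfl : 2 * 1 + 2 * 2 + 2 * 2 = 2 * 1 + 2 * (2 + 2))
                    (cupProduct (rfl : 2 * 1 + 2 * 2 = 2 * 1 + 2 * 2)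
                      (complexBetti.map (SemiCartesianMonoidalCategory.snd A B) (2 * 1)
                        (complexGysin μ (IsSmoothProjective.tensor_holds hB hC) hB
                          (SemiCartesianMonoidalCategory.fst B C)
                          (rfl : 2 * 1 + 2 * 2 + 2 * 2 = 2 * 1 + 2 * (2 + 2))
                          (cupProduct (rfl : 2 * 1 + 2 * 2 = 2 * 1 + 2 * 2)
                            (complexBetti.map (SemiCartesianMonoidalCategory.snd B C) (2 * 1) x)
                            γ₁)))
                      γ))
    (hA : ∀ (μ : OrientationFamily), μ.HasPoincareDuality →
      ∀ (S : SchemeOver ℂ)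
        (hS : (IsSmoothProjective 2 S ∧ Subsingleton (structureSheafCohomology S.left 1) ∧
          ∃ (A : HodgeModel 2 S) (η : MForm 𝓘(ℝ, A.model) A.carrier ℂ 2),
            IsHolomorphicInCharts η ∧ ∀ x, η x ≠ 0))
        (p : complexBetti S (2 * 2)),
        (IsIntegralClass p ∧ ∀ q : complexBetti S (2 * 2), IsIntegralClass q → ∃ n : ℤ, q = n • p) →
        ∃ (S'' : SchemeOver ℂ)
          (hS'' : (IsSmoothProjective 2 S'' ∧ Subsingleton (structureSheafCohomology S''.left 1) ∧
            ∃ (A : HodgeModel 2 S'') (η : MForm 𝓘(ℝ, A.model) A.carrier ℂ 2),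
              IsHolomorphicInCharts η ∧ ∀ x, η x ≠ 0))
          (p'' : complexBetti S'' (2 * 2)),
          (IsIntegralClass p'' ∧
            ∀ q : complexBetti S'' (2 * 2), IsIntegralClass q → ∃ n : ℤ, q = n • p'') ∧
          ∃ Ψ : complexBetti S'' (2 * 1) ≃ₗ[ℂ] complexBetti S (2 * 1),
            (∀ y, IsRationalClass y → IsRationalClass (Ψ.symm y)) ∧
            (∀ (i j : ℕ) y, IsOfHodgeType 2 S (2 * 1) i j y →
              IsOfHodgeType 2 S'' (2 * 1) i j (Ψ.symm y)) ∧
            (∀ (u v : complexBetti S (2 * 1)) (b : ℂ),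
              cupProduct (rfl : 2 * 1 + 2 * 1 = 2 * 2) u v = (r * b) • p →
                cupProduct (rfl : 2 * 1 + 2 * 1 = 2 * 2) (Ψ.symm u) (Ψ.symm v) = b • p'') ∧
            ∃ γ ∈ algebraicClasses (MonoidalCategoryStruct.tensorObj S S'') 2,
              ∀ x : complexBetti S'' (2 * 1),
                Ψ x = complexGysin μ (IsSmoothProjective.tensor_holds hS.1 hS''.1) hS.1
                  (SemiCartesianMonoidalCategory.fst S S'')
                  (rfl : 2 * 1 + 2 * 2 + 2 * 2 = 2 * 1 + 2 * (2 + 2))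
                  (cupProduct (rfl : 2 * 1 + 2 * 2 = 2 * 1 + 2 * 2)
                    (complexBetti.map (SemiCartesianMonoidalCategory.snd S S'') (2 * 1) x) γ)) :
    ∀ (μ : OrientationFamily), μ.HasPoincareDuality →
      ∀ (S S' : SchemeOver ℂ)
        (hS : (IsSmoothProjective 2 S ∧ Subsingleton (structureSheafCohomology S.left 1) ∧
          ∃ (A : HodgeModel 2 S) (η : MForm 𝓘(ℝ, A.model) A.carrier ℂ 2),
            IsHolomorphicInCharts η ∧ ∀ x, η x ≠ 0))
        (hS' : (IsSmoothProjective 2 S' ∧ Subsingleton (structureSheafCohomology S'.left 1) ∧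
          ∃ (A : HodgeModel 2 S') (η : MForm 𝓘(ℝ, A.model) A.carrier ℂ 2),
            IsHolomorphicInCharts η ∧ ∀ x, η x ≠ 0))
        (p : complexBetti S (2 * 2)) (p' : complexBetti S' (2 * 2)),
        (IsIntegralClass p ∧ ∀ q : complexBetti S (2 * 2), IsIntegralClass q → ∃ n : ℤ, q = n • p) →
        (IsIntegralClass p' ∧
          ∀ q : complexBetti S' (2 * 2), IsIntegralClass q → ∃ n : ℤ, q = n • p') →
        ∀ (ψ : complexBetti S' (2 * 1) →ₗ[ℂ] complexBetti S (2 * 1)),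
          (∀ x, IsRationalClass x → IsRationalClass (ψ x)) →
          (∀ (i j : ℕ) x, IsOfHodgeType 2 S' (2 * 1) i j x → IsOfHodgeType 2 S (2 * 1) i j (ψ x)) →
          (∀ (x y : complexBetti S' (2 * 1)) (a : ℂ),
            cupProduct (rfl : 2 * 1 + 2 * 1 = 2 * 2) x y = a • p' →
              cupProduct (rfl : 2 * 1 + 2 * 1 = 2 * 2) (ψ x) (ψ y) = (r * a) • p) →
          ∃ γ ∈ algebraicClasses (MonoidalCategoryStruct.tensorObj S S') 2,
            ∀ x : complexBetti S' (2 * 1),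
              ψ x = complexGysin μ (IsSmoothProjective.tensor_holds hS.1 hS'.1) hS.1
                (SemiCartesianMonoidalCategory.fst S S')
                (rfl : 2 * 1 + 2 * 2 + 2 * 2 = 2 * 1 + 2 * (2 + 2))
                (cupProduct (rfl : 2 * 1 + 2 * 2 = 2 * 1 + 2 * 2)
                  (complexBetti.map (SemiCartesianMonoidalCategory.snd S S') (2 * 1) x) γ) := by
  intro μ hμ S S' hS hS' p p' hp hp' ψ hψr hψt hψs
  obtain ⟨S'', hS'', p'', hp'', Ψ, hΨr, hΨt, hΨs, γ, hγ, hΨγ⟩ := hA μ hμ S hS p hp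
  -- `φ := Ψ⁻¹ ∘ ψ : H²(S′) → H²(S″)` is a rational Hodge isometry.
  have hφr : ∀ x, IsRationalClass x → IsRationalClass ((Ψ.symm.toLinearMap ∘ₗ ψ) x) :=
    fun x hx => hΨr _ (hψr x hx)
  have hφt : ∀ (i j : ℕ) x, IsOfHodgeType 2 S' (2 * 1) i j x →
      IsOfHodgeType 2 S'' (2 * 1) i j ((Ψ.symm.toLinearMap ∘ₗ ψ) x) :=
    fun i j x hx => hΨt i j _ (hψt i j x hx)
  have hφs : ∀ (x y : complexBetti S' (2 * 1)) (a : ℂ),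
      cupProduct (rfl : 2 * 1 + 2 * 1 = 2 * 2) x y = a • p' →
        cupProduct (rfl : 2 * 1 + 2 * 1 = 2 * 2) ((Ψ.symm.toLinearMap ∘ₗ ψ) x)
          ((Ψ.symm.toLinearMap ∘ₗ ψ) y) = a • p'' :=
    fun x y a hxy => hΨs _ _ a (hψs x y a hxy)
  -- Buskin for the K3 pair `(S″, S′)`, then compose with the algebraic anchor `Ψ = [γ]_*`.
  obtain ⟨γ₁, hγ₁, hφγ₁⟩ :=
    hB μ hμ S'' S' hS'' hS' p'' p' hp'' hp' (Ψ.symm.toLinearMap ∘ₗ ψ) hφr hφt hφs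
  obtain ⟨γ₂, hγ₂, hcomp⟩ := hC μ hμ S S'' S' hS.1 hS''.1 hS'.1 γ hγ γ₁ hγ₁
  refine ⟨γ₂, hγ₂, fun x => ?_⟩
  rw [hcomp x, ← hφγ₁ x, ← hΨγ]
  simp

/-- **The route's target X = Sim₂(K3) from an algebraic anchor `2`-similitude** (glue for a split of
item stmt-HodgeConjecture-13674): `HodgeIsometryAlgebraic` (Buskin) + composition of algebraic
correspondences between smooth projective surfaces + "every projective K3 surface has a projective
K3 partner and an ALGEBRAIC `ℂ`-linear equivalence `Ψ : H²(S″) ≃ H²(S)` whose inverse is a rational,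
type-preserving `½`-similitude" imply `TwinSimilitudeAlgebraic` (every rational Hodge
`2`-similitude between projective K3 surfaces is algebraic). The case `r = 2` of
`similitudeAlgebraic_of_anchor`. [folklore] -/
theorem twinSimilitudeAlgebraic_of_anchor (hB : HodgeIsometryAlgebraic)
    (hC : ∀ (μ : OrientationFamily), μ.HasPoincareDuality →
      ∀ (A B C : SchemeOver ℂ) (hA : IsSmoothProjective 2 A) (hB : IsSmoothProjective 2 B)
        (hC : IsSmoothProjective 2 C),
        ∀ γ ∈ algebraicClasses (MonoidalCategoryStruct.tensorObj A B) 2,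
          ∀ γ₁ ∈ algebraicClasses (MonoidalCategoryStruct.tensorObj B C) 2,
            ∃ γ₂ ∈ algebraicClasses (MonoidalCategoryStruct.tensorObj A C) 2,
              ∀ x : complexBetti C (2 * 1),
                complexGysin μ (IsSmoothProjective.tensor_holds hA hC) hA
                    (SemiCartesianMonoidalCategory.fst A C)
                    (rfl : 2 * 1 + 2 * 2 + 2 * 2 = 2 * 1 + 2 * (2 + 2))
                    (cupProduct (rfl : 2 * 1 + 2 * 2 = 2 * 1 + 2 * 2)
                      (complexBetti.map (SemiCartesianMonoidalCategory.snd A C) (2 * 1) x) γ₂) =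
                  complexGysin μ (IsSmoothProjective.tensor_holds hA hB) hA
                    (SemiCartesianMonoidalCategory.fst A B)
                    (rfl : 2 * 1 + 2 * 2 + 2 * 2 = 2 * 1 + 2 * (2 + 2))
                    (cupProduct (rfl : 2 * 1 + 2 * 2 = 2 * 1 + 2 * 2)
                      (complexBetti.map (SemiCartesianMonoidalCategory.snd A B) (2 * 1)
                        (complexGysin μ (IsSmoothProjective.tensor_holds hB hC) hB
                          (SemiCartesianMonoidalCategory.fst B C)
                          (rfl : 2 * 1 + 2 * 2 + 2 * 2 = 2 * 1 + 2 * (2 + 2))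
                          (cupProduct (rfl : 2 * 1 + 2 * 2 = 2 * 1 + 2 * 2)
                            (complexBetti.map (SemiCartesianMonoidalCategory.snd B C) (2 * 1) x)
                            γ₁)))
                      γ))
    (hA : ∀ (μ : OrientationFamily), μ.HasPoincareDuality →
      ∀ (S : SchemeOver ℂ)
        (hS : (IsSmoothProjective 2 S ∧ Subsingleton (structureSheafCohomology S.left 1) ∧
          ∃ (A : HodgeModel 2 S) (η : MForm 𝓘(ℝ, A.model) A.carrier ℂ 2),
            IsHolomorphicInCharts η ∧ ∀ x, η x ≠ 0))
        (p : complexBetti S (2 * 2)),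
        (IsIntegralClass p ∧ ∀ q : complexBetti S (2 * 2), IsIntegralClass q → ∃ n : ℤ, q = n • p) →
        ∃ (S'' : SchemeOver ℂ)
          (hS'' : (IsSmoothProjective 2 S'' ∧ Subsingleton (structureSheafCohomology S''.left 1) ∧
            ∃ (A : HodgeModel 2 S'') (η : MForm 𝓘(ℝ, A.model) A.carrier ℂ 2),
              IsHolomorphicInCharts η ∧ ∀ x, η x ≠ 0))
          (p'' : complexBetti S'' (2 * 2)),
          (IsIntegralClass p'' ∧
            ∀ q : complexBetti S'' (2 * 2), IsIntegralClass q → ∃ n : ℤ, q = n • p'') ∧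
          ∃ Ψ : complexBetti S'' (2 * 1) ≃ₗ[ℂ] complexBetti S (2 * 1),
            (∀ y, IsRationalClass y → IsRationalClass (Ψ.symm y)) ∧
            (∀ (i j : ℕ) y, IsOfHodgeType 2 S (2 * 1) i j y →
              IsOfHodgeType 2 S'' (2 * 1) i j (Ψ.symm y)) ∧
            (∀ (u v : complexBetti S (2 * 1)) (b : ℂ),
              cupProduct (rfl : 2 * 1 + 2 * 1 = 2 * 2) u v = (2 * b) • p →
                cupProduct (rfl : 2 * 1 + 2 * 1 = 2 * 2) (Ψ.symm u) (Ψ.symm v) = b • p'') ∧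
            ∃ γ ∈ algebraicClasses (MonoidalCategoryStruct.tensorObj S S'') 2,
              ∀ x : complexBetti S'' (2 * 1),
                Ψ x = complexGysin μ (IsSmoothProjective.tensor_holds hS.1 hS''.1) hS.1
                  (SemiCartesianMonoidalCategory.fst S S'')
                  (rfl : 2 * 1 + 2 * 2 + 2 * 2 = 2 * 1 + 2 * (2 + 2))
                  (cupProduct (rfl : 2 * 1 + 2 * 2 = 2 * 1 + 2 * 2)
                    (complexBetti.map (SemiCartesianMonoidalCategory.snd S S'') (2 * 1) x) γ)) :
    TwinSimilitudeAlgebraic :=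
  similitudeAlgebraic_of_anchor 2 hB hC hA

/-- **All multipliers** (glue for item stmt-HodgeConjecture-13676 `HodgeSimilitudeAlgebraic`, card
item K4): `HodgeIsometryAlgebraic` + composition of algebraic correspondences + an algebraic anchor
`r`-similitude for every rational `r > 0` and every projective K3 surface imply that every rational
Hodge similitude of every positive rational multiplier between projective K3 surfaces is algebraic.
From `similitudeAlgebraic_of_anchor` at `r : ℚ ↪ ℂ`. [folklore] -/
theorem hodgeSimilitudeAlgebraic_of_anchor (hB : HodgeIsometryAlgebraic)
    (hC : ∀ (μ : OrientationFamily), μ.HasPoincareDuality →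
      ∀ (A B C : SchemeOver ℂ) (hA : IsSmoothProjective 2 A) (hB : IsSmoothProjective 2 B)
        (hC : IsSmoothProjective 2 C),
        ∀ γ ∈ algebraicClasses (MonoidalCategoryStruct.tensorObj A B) 2,
          ∀ γ₁ ∈ algebraicClasses (MonoidalCategoryStruct.tensorObj B C) 2,
            ∃ γ₂ ∈ algebraicClasses (MonoidalCategoryStruct.tensorObj A C) 2,
              ∀ x : complexBetti C (2 * 1),
                complexGysin μ (IsSmoothProjective.tensor_holds hA hC) hA
                    (SemiCartesianMonoidalCategory.fst A C)
                    (rfl : 2 * 1 + 2 * 2 + 2 * 2 = 2 * 1 + 2 * (2 + 2))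
                    (cupProduct (rfl : 2 * 1 + 2 * 2 = 2 * 1 + 2 * 2)
                      (complexBetti.map (SemiCartesianMonoidalCategory.snd A C) (2 * 1) x) γ₂) =
                  complexGysin μ (IsSmoothProjective.tensor_holds hA hB) hA
                    (SemiCartesianMonoidalCategory.fst A B)
                    (rfl : 2 * 1 + 2 * 2 + 2 * 2 = 2 * 1 + 2 * (2 + 2))
                    (cupProduct (rfl : 2 * 1 + 2 * 2 = 2 * 1 + 2 * 2)
                      (complexBetti.map (SemiCartesianMonoidalCategory.snd A B) (2 * 1)
                        (complexGysin μ (IsSmoothProjective.tensor_holds hB hC) hB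
                          (SemiCartesianMonoidalCategory.fst B C)
                          (rfl : 2 * 1 + 2 * 2 + 2 * 2 = 2 * 1 + 2 * (2 + 2))
                          (cupProduct (rfl : 2 * 1 + 2 * 2 = 2 * 1 + 2 * 2)
                            (complexBetti.map (SemiCartesianMonoidalCategory.snd B C) (2 * 1) x)
                            γ₁)))
                      γ))
    (hA : ∀ (r : ℚ), 0 < r → ∀ (μ : OrientationFamily), μ.HasPoincareDuality →
      ∀ (S : SchemeOver ℂ)
        (hS : (IsSmoothProjective 2 S ∧ Subsingleton (structureSheafCohomology S.left 1) ∧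
          ∃ (A : HodgeModel 2 S) (η : MForm 𝓘(ℝ, A.model) A.carrier ℂ 2),
            IsHolomorphicInCharts η ∧ ∀ x, η x ≠ 0))
        (p : complexBetti S (2 * 2)),
        (IsIntegralClass p ∧ ∀ q : complexBetti S (2 * 2), IsIntegralClass q → ∃ n : ℤ, q = n • p) →
        ∃ (S'' : SchemeOver ℂ)
          (hS'' : (IsSmoothProjective 2 S'' ∧ Subsingleton (structureSheafCohomology S''.left 1) ∧
            ∃ (A : HodgeModel 2 S'') (η : MForm 𝓘(ℝ, A.model) A.carrier ℂ 2),
              IsHolomorphicInCharts η ∧ ∀ x, η x ≠ 0))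
          (p'' : complexBetti S'' (2 * 2)),
          (IsIntegralClass p'' ∧
            ∀ q : complexBetti S'' (2 * 2), IsIntegralClass q → ∃ n : ℤ, q = n • p'') ∧
          ∃ Ψ : complexBetti S'' (2 * 1) ≃ₗ[ℂ] complexBetti S (2 * 1),
            (∀ y, IsRationalClass y → IsRationalClass (Ψ.symm y)) ∧
            (∀ (i j : ℕ) y, IsOfHodgeType 2 S (2 * 1) i j y →
              IsOfHodgeType 2 S'' (2 * 1) i j (Ψ.symm y)) ∧
            (∀ (u v : complexBetti S (2 * 1)) (b : ℂ),
              cupProduct (rfl : 2 * 1 + 2 * 1 = 2 * 2) u v = ((r : ℂ) * b) • p →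
                cupProduct (rfl : 2 * 1 + 2 * 1 = 2 * 2) (Ψ.symm u) (Ψ.symm v) = b • p'') ∧
            ∃ γ ∈ algebraicClasses (MonoidalCategoryStruct.tensorObj S S'') 2,
              ∀ x : complexBetti S'' (2 * 1),
                Ψ x = complexGysin μ (IsSmoothProjective.tensor_holds hS.1 hS''.1) hS.1
                  (SemiCartesianMonoidalCategory.fst S S'')
                  (rfl : 2 * 1 + 2 * 2 + 2 * 2 = 2 * 1 + 2 * (2 + 2))
                  (cupProduct (rfl : 2 * 1 + 2 * 2 = 2 * 1 + 2 * 2)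
                    (complexBetti.map (SemiCartesianMonoidalCategory.snd S S'') (2 * 1) x) γ)) :
    HodgeSimilitudeAlgebraic :=
  fun r hr => similitudeAlgebraic_of_anchor (r : ℂ) hB hC (hA r hr)

end Summit.HodgeConjecture.HodgeConjecture.Theorems

end
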